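import Summits.HodgeConjecture.HodgeConjecture.Theorems.NoetherLefschetzOneUpK3TypeNetsPgZeroFactor
import Literature.AlgebraicGeometry.HodgeTheory.AlgebraicClassesExteriorProduct
import Literature.AlgebraicGeometry.HodgeTheory.HypersurfaceLefschetz

/-!
# Varieties all of whose cohomology is algebraic are closed under products — the Hodge conjecture
# for arbitrary products of `p_g = q = 0` surfaces (and `b₁ = 0` curves), in support of crux
# `SummitGrantedFourfolds` (stmt-HodgeConjecture-14600)

Route `HodgeConjecture/NoetherLefschetzOneUp`, crux `SummitGrantedFourfolds` (stmt-HodgeConjecture-14600: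
the Hodge conjecture beyond dimension four, granted the fourfold middle degree). This helper lands an
UNCONDITIONAL family of instances of `HodgeConjectureFor` in EVERY dimension, complementing the sibling
files `NoetherLefschetzOneUpK3TypeNetsPgZeroFactor` (dimension 4) and
`NoetherLefschetzOneUpSummitGrantedFourfoldsProductsPgqZeroSurface` (dimensions 4, 5), whose divisor-descent
step (`NodalSupport.DivisorInduction`) stops in the middle degree of a sixfold.

Say a smooth projective `V` is COHOMOLOGICALLY ALGEBRAIC (spelled out as two hypotheses, no definition):
`algebraicClasses V k = Nᵏ H²ᵏ(V(ℂ); ℂ) = H²ᵏ(V(ℂ); ℂ)` for every `k`, and `H^{2k+1}(V(ℂ); ℂ) = 0` for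
every `k`. Then:

* `algebraicClasses_tensor_eq_top`, `subsingleton_complexBetti_tensor_odd` — **the product `V ⊗ V'` of
  two cohomologically algebraic varieties is cohomologically algebraic**: by the Künneth theorem
  (`kunnethSpan_complexBetti`) `H*((V ⊗ V')(ℂ))` is spanned by `pr₁^* a ∪ pr₂^* b`; a monomial with a
  factor of odd degree vanishes, and for `a ∈ Nⁱ H²ⁱ(V)`, `b ∈ Nʲ H²ʲ(V')` the EXTERIOR PRODUCT lies in
  `N^{i+j} H^{2(i+j)}(V ⊗ V')` — the tree's PROVED `cupProduct_map_fst_map_snd_mem_supportedClasses`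
  (Voisin II, proof of Prop. 9.20, first display: `[Z × Z'] = pr₁^*[Z] ∪ pr₂^*[Z']`; codimensions add on
  products, Hartshorne III 9.5 — no moving lemma);
* `hodgeConjectureFor_of_algebraicClasses_eq_top` — a cohomologically algebraic variety satisfies the
  Hodge conjecture in the summit's spelling (trivially: every class is algebraic; Hodge models exist);
* `algebraicClasses_eq_top_of_pg_zero`, `subsingleton_complexBetti_odd_of_b₁` — **a smooth projective
  SURFACE with `p_g = 0` and `b₁ = 0` is cohomologically algebraic** (`H² = N¹` by the Lefschetz `(1,1)`
  fibre step `algebraicClasses_one_eq_top_of_pg_zero`; `H⁰`, `H⁴`; `H³ ≅ H¹ = 0` by hard Lefschetz,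
  `nonempty_hardLefschetzNFold_holds 2`); `algebraicClasses_eq_top_curve`, `subsingleton_complexBetti_odd_curve`
  — so is a smooth projective CURVE with `b₁ = 0`;
* hence (`hodgeConjectureFor_tensor`, `hodgeConjectureFor_tensor₃_surfaces`, …) **the Hodge conjecture holds
  for every finite product of surfaces with `p_g = q = 0` (Enriques, rational, Godeaux, Campedelli,
  Burniat, Beauville surfaces …) and curves `≅ ℙ¹`, in every dimension** — e.g. the sixfold
  `Enriques × Enriques × Enriques`, beyond the reach of the divisor-descent files.

No definition, no named-fact hypothesis, no `sorry`.

References: Voisin, *Hodge Theory and Complex Algebraic Geometry II*, Prop. 9.20 (proof, first display);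
Voisin I, Thm. 11.30, Thm. 6.25; Hatcher, *Algebraic Topology*, Thm. 3.16; Hartshorne III Prop. 9.5.
-/

-- `Summit.HodgeConjecture.HodgeConjecture.Theorems` is the mandated namespace (single-conjunct summit),
-- which `linter.dupNamespace` flags; the lakefile turns the linter off tree-wide, restated here so
-- stand-alone elaboration is warning-free too.
set_option linter.dupNamespace false

noncomputable section

open CategoryTheory AlgebraicGeometry MonoidalCategory CartesianMonoidalCategory
open Literature.AlgebraicGeometry Literature.AlgebraicGeometry.Motives
open Literature.AlgebraicGeometry.HodgeTheory Literature.AlgebraicTopology.SingularHomology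

namespace Summit.HodgeConjecture.HodgeConjecture.Theorems

namespace CohomologicallyAlgebraic

/-! ### Cohomologically algebraic varieties satisfy the Hodge conjecture -/

/-- If every even-degree class of `X` is algebraic (`Nᵏ H²ᵏ = H²ᵏ` for all `k`), then `X` satisfies the
Hodge conjecture in the summit's spelling (Hodge models exist by `nonempty_hodgeModel_holds`).
[cite: Deligne2000, §1] -/
theorem hodgeConjectureFor_of_algebraicClasses_eq_top {n : ℕ} {X : SchemeOver ℂ}
    (hX : IsSmoothProjective n X) (hev : ∀ k : ℕ, algebraicClasses X k = ⊤) :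
    HodgeConjectureFor n X :=
  ⟨nonempty_hodgeModel_holds hX, fun p _ _ _ ↦ (hev p).symm ▸ Submodule.mem_top⟩

/-! ### Closure under products -/

/-- **Even degrees of a product of cohomologically algebraic varieties are algebraic.** For smooth
projective `V`, `V'` with `Nᵏ H²ᵏ = H²ᵏ` and `H^{odd} = 0` on both, `Nᵏ H²ᵏ((V ⊗ V')(ℂ); ℂ) = H²ᵏ` for
every `k`: Künneth monomials `pr₁^* a ∪ pr₂^* b` with an odd-degree factor vanish, and the exterior
product of `a ∈ Nⁱ H²ⁱ(V)` and `b ∈ Nʲ H²ʲ(V')` lies in `N^{i+j}`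
(`cupProduct_map_fst_map_snd_mem_supportedClasses`). [cite: VoisinHodgeII2003, proof of Prop. 9.20 (first display)]
[cite: HatcherAT2002, §3.2 Thm. 3.16] -/
theorem algebraicClasses_tensor_eq_top {d d' : ℕ} {V V' : SchemeOver ℂ}
    (hV : IsSmoothProjective d V) (hV' : IsSmoothProjective d' V')
    (hev : ∀ k : ℕ, algebraicClasses V k = ⊤) (hodd : ∀ k : ℕ, Subsingleton (complexBetti V (2 * k + 1)))
    (hev' : ∀ k : ℕ, algebraicClasses V' k = ⊤)
    (hodd' : ∀ k : ℕ, Subsingleton (complexBetti V' (2 * k + 1))) (k : ℕ) :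
    algebraicClasses (V ⊗ V') k = ⊤ := by
  rw [eq_top_iff]
  intro z _
  refine (Submodule.span_le.mpr ?_) (kunnethSpan_complexBetti hV hV' (2 * k) z)
  rintro v ⟨i, j, hij, a, b, rfl⟩
  obtain ⟨i', rfl | rfl⟩ := Nat.even_or_odd' i
  · obtain ⟨j', rfl | rfl⟩ := Nat.even_or_odd' j
    · -- both degrees even: exterior product of algebraic classes
      obtain rfl : k = i' + j' := by omega
      have ha : a ∈ supportedClasses V (2 * i') i' := by
        change a ∈ algebraicClasses V i'
        rw [hev i']; exact Submodule.mem_top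
      have hb : b ∈ supportedClasses V' (2 * j') j' := by
        change b ∈ algebraicClasses V' j'
        rw [hev' j']; exact Submodule.mem_top
      exact cupProduct_map_fst_map_snd_mem_supportedClasses hV hV' hij ha hb
    · -- `deg b` odd
      haveI := hodd' j'
      rw [Subsingleton.elim b 0, map_zero, map_zero]
      exact Submodule.zero_mem _
  · -- `deg a` odd
    haveI := hodd i'
    rw [Subsingleton.elim a 0, map_zero, LinearMap.map_zero₂]
    exact Submodule.zero_mem _

/-- **Odd degrees of a product of cohomologically algebraic varieties vanish**: every Künneth monomial
of odd total degree has a factor of odd degree. [cite: HatcherAT2002, §3.2 Thm. 3.16] -/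
theorem subsingleton_complexBetti_tensor_odd {d d' : ℕ} {V V' : SchemeOver ℂ}
    (hV : IsSmoothProjective d V) (hV' : IsSmoothProjective d' V')
    (hodd : ∀ k : ℕ, Subsingleton (complexBetti V (2 * k + 1)))
    (hodd' : ∀ k : ℕ, Subsingleton (complexBetti V' (2 * k + 1))) (k : ℕ) :
    Subsingleton (complexBetti (V ⊗ V') (2 * k + 1)) := by
  refine subsingleton_of_forall_eq 0 fun z ↦ ?_
  have hz := kunnethSpan_complexBetti hV hV' (2 * k + 1) z
  suffices h : Submodule.span ℂ {v | ∃ (i j : ℕ) (h : i + j = 2 * k + 1) (b : complexBetti V i)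
      (w : complexBetti V' j), v = cupProduct h (complexBetti.map (fst V V') i b)
        (complexBetti.map (snd V V') j w)} ≤ ⊥ from (Submodule.mem_bot ℂ).mp (h hz)
  refine Submodule.span_le.mpr ?_
  rintro v ⟨i, j, hij, a, b, rfl⟩
  obtain ⟨i', rfl | rfl⟩ := Nat.even_or_odd' i
  · obtain ⟨j', rfl | rfl⟩ := Nat.even_or_odd' j
    · exact absurd hij (by omega)
    · haveI := hodd' j'
      rw [Subsingleton.elim b 0, map_zero, map_zero]
      exact Submodule.zero_mem _
  · haveI := hodd i'
    rw [Subsingleton.elim a 0, map_zero, LinearMap.map_zero₂]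
    exact Submodule.zero_mem _

/-- **The Hodge conjecture for the product of two cohomologically algebraic varieties.**
[cite: VoisinHodgeII2003, proof of Prop. 9.20 (first display)] [cite: Deligne2000, §1] -/
theorem hodgeConjectureFor_tensor {d d' : ℕ} {V V' : SchemeOver ℂ}
    (hV : IsSmoothProjective d V) (hV' : IsSmoothProjective d' V')
    (hev : ∀ k : ℕ, algebraicClasses V k = ⊤) (hodd : ∀ k : ℕ, Subsingleton (complexBetti V (2 * k + 1)))
    (hev' : ∀ k : ℕ, algebraicClasses V' k = ⊤)
    (hodd' : ∀ k : ℕ, Subsingleton (complexBetti V' (2 * k + 1))) :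
    HodgeConjectureFor (d + d') (V ⊗ V') :=
  hodgeConjectureFor_of_algebraicClasses_eq_top (IsSmoothProjective.tensor_holds hV hV')
    (algebraicClasses_tensor_eq_top hV hV' hev hodd hev' hodd')

/-! ### Surfaces with `p_g = q = 0` and curves with `b₁ = 0` are cohomologically algebraic -/

/-- **On a smooth projective surface with `p_g = 0` every even-degree class is algebraic**: `H⁰`
(`algebraicClasses_zero`), `H² = N¹` (`algebraicClasses_one_eq_top_of_pg_zero` with
`lefschetzOneOne_rational_holds`), `H⁴` and beyond (`algebraicClasses_eq_top_of_eq_zero_or_le`).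
[cite: VoisinHodgeI2002, Thm. 11.30] -/
theorem algebraicClasses_eq_top_of_pg_zero {S : SchemeOver ℂ} (hS : IsSmoothProjective 2 S)
    (hpg : ∃ A : HodgeModel 2 S, Module.finrank ℂ ↥(A.hodgePQ 2 2 0) = 0) (k : ℕ) :
    algebraicClasses S k = ⊤ := by
  by_cases hk : k = 1
  · subst hk
    exact algebraicClasses_one_eq_top_of_pg_zero lefschetzOneOne_rational_holds hS hpg
  · exact algebraicClasses_eq_top_of_eq_zero_or_le hS (by omega)

/-- **On a smooth projective surface with `b₁ = 0` every odd-degree class vanishes**: `H¹ = 0` by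
hypothesis, `H³ ≅ H¹` by hard Lefschetz (`nonempty_hardLefschetzNFold_holds 2 S`), `H^{≥5} = 0` above
twice the dimension. [cite: VoisinHodgeI2002, Thm. 6.25] -/
theorem subsingleton_complexBetti_odd_of_b₁ {S : SchemeOver ℂ} (hS : IsSmoothProjective 2 S)
    (hq : Subsingleton (complexBetti S 1)) (k : ℕ) : Subsingleton (complexBetti S (2 * k + 1)) := by
  rcases Nat.lt_or_ge k 2 with hk | hk
  · interval_cases k
    · exact hq
    · obtain ⟨Λ⟩ := nonempty_hardLefschetzNFold_holds 2 S hS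
      exact (Λ.bijective_L (j := 1) (k := 1) (by norm_num) (2 * 1 + 1) (by norm_num)).2.subsingleton
  · exact subsingleton_complexBetti hS (by omega)

/-- **On a smooth projective curve every even-degree class is algebraic** (`H⁰` and the top degree
`H²`; nothing above). [cite: VoisinHodgeI2002, §11.1.2] -/
theorem algebraicClasses_eq_top_curve {C : SchemeOver ℂ} (hC : IsSmoothProjective 1 C) (k : ℕ) :
    algebraicClasses C k = ⊤ :=
  algebraicClasses_eq_top_of_eq_zero_or_le hC (by omega)

/-- **On a smooth projective curve with `b₁ = 0` every odd-degree class vanishes** (`H¹ = 0` by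
hypothesis, `H^{≥3} = 0`). [cite: HatcherAT2002, §3.3] -/
theorem subsingleton_complexBetti_odd_curve {C : SchemeOver ℂ} (hC : IsSmoothProjective 1 C)
    (h1 : Subsingleton (complexBetti C 1)) (k : ℕ) : Subsingleton (complexBetti C (2 * k + 1)) := by
  rcases Nat.eq_zero_or_pos k with rfl | hk
  · exact h1
  · exact subsingleton_complexBetti hC (by omega)

/-! ### The Hodge conjecture for products of `p_g = q = 0` surfaces (every dimension) -/

/-- **The Hodge conjecture for `S₁ × S₂`, both surfaces with `p_g = 0` and `b₁ = 0`**, with the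
stronger output that `S₁ × S₂` is again cohomologically algebraic (first conjunct), so that the
construction iterates. [cite: VoisinHodgeII2003, proof of Prop. 9.20 (first display)]
[cite: VoisinHodgeI2002, Thm. 11.30] -/
theorem cohomologicallyAlgebraic_tensor_surfaces {S₁ S₂ : SchemeOver ℂ}
    (h₁ : IsSmoothProjective 2 S₁) (h₂ : IsSmoothProjective 2 S₂)
    (hpg₁ : ∃ A : HodgeModel 2 S₁, Module.finrank ℂ ↥(A.hodgePQ 2 2 0) = 0)
    (hq₁ : Subsingleton (complexBetti S₁ 1))
    (hpg₂ : ∃ A : HodgeModel 2 S₂, Module.finrank ℂ ↥(A.hodgePQ 2 2 0) = 0)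
    (hq₂ : Subsingleton (complexBetti S₂ 1)) :
    (∀ k : ℕ, algebraicClasses (S₁ ⊗ S₂) k = ⊤) ∧
      (∀ k : ℕ, Subsingleton (complexBetti (S₁ ⊗ S₂) (2 * k + 1))) ∧
      HodgeConjectureFor 4 (S₁ ⊗ S₂) :=
  ⟨algebraicClasses_tensor_eq_top h₁ h₂ (algebraicClasses_eq_top_of_pg_zero h₁ hpg₁)
      (subsingleton_complexBetti_odd_of_b₁ h₁ hq₁) (algebraicClasses_eq_top_of_pg_zero h₂ hpg₂)
      (subsingleton_complexBetti_odd_of_b₁ h₂ hq₂),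
    subsingleton_complexBetti_tensor_odd h₁ h₂ (subsingleton_complexBetti_odd_of_b₁ h₁ hq₁)
      (subsingleton_complexBetti_odd_of_b₁ h₂ hq₂),
    hodgeConjectureFor_tensor h₁ h₂ (algebraicClasses_eq_top_of_pg_zero h₁ hpg₁)
      (subsingleton_complexBetti_odd_of_b₁ h₁ hq₁) (algebraicClasses_eq_top_of_pg_zero h₂ hpg₂)
      (subsingleton_complexBetti_odd_of_b₁ h₂ hq₂)⟩

/-- **The Hodge conjecture for the sixfold `(S₁ × S₂) × S₃`, all three surfaces with `p_g = 0` and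
`b₁ = 0`** (e.g. `Enriques × Enriques × Enriques`) — in every codimension, including the middle one,
out of reach of the divisor-descent step of the sibling files. [cite: VoisinHodgeII2003, proof of Prop. 9.20 (first display)]
[cite: VoisinHodgeI2002, Thm. 11.30 and Thm. 6.25] -/
theorem hodgeConjectureFor_tensor₃_surfaces {S₁ S₂ S₃ : SchemeOver ℂ}
    (h₁ : IsSmoothProjective 2 S₁) (h₂ : IsSmoothProjective 2 S₂) (h₃ : IsSmoothProjective 2 S₃)
    (hpg₁ : ∃ A : HodgeModel 2 S₁, Module.finrank ℂ ↥(A.hodgePQ 2 2 0) = 0)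
    (hq₁ : Subsingleton (complexBetti S₁ 1))
    (hpg₂ : ∃ A : HodgeModel 2 S₂, Module.finrank ℂ ↥(A.hodgePQ 2 2 0) = 0)
    (hq₂ : Subsingleton (complexBetti S₂ 1))
    (hpg₃ : ∃ A : HodgeModel 2 S₃, Module.finrank ℂ ↥(A.hodgePQ 2 2 0) = 0)
    (hq₃ : Subsingleton (complexBetti S₃ 1)) :
    HodgeConjectureFor 6 ((S₁ ⊗ S₂) ⊗ S₃) := by
  obtain ⟨hev, hodd, -⟩ := cohomologicallyAlgebraic_tensor_surfaces h₁ h₂ hpg₁ hq₁ hpg₂ hq₂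
  exact hodgeConjectureFor_tensor (IsSmoothProjective.tensor_holds h₁ h₂) h₃ hev hodd
    (algebraicClasses_eq_top_of_pg_zero h₃ hpg₃) (subsingleton_complexBetti_odd_of_b₁ h₃ hq₃)

/-- **The Hodge conjecture for `C × S`, `C` a curve with `b₁ = 0` and `S` a surface with `p_g = 0`,
`b₁ = 0`** (a threefold; classical — recorded as the smallest mixed instance of the closure theorem).
[cite: VoisinHodgeI2002, Thm. 11.30 and Thm. 6.25] -/
theorem hodgeConjectureFor_curve_tensor_surface {C S : SchemeOver ℂ}
    (hC : IsSmoothProjective 1 C) (hS : IsSmoothProjective 2 S)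
    (h1 : Subsingleton (complexBetti C 1))
    (hpg : ∃ A : HodgeModel 2 S, Module.finrank ℂ ↥(A.hodgePQ 2 2 0) = 0)
    (hq : Subsingleton (complexBetti S 1)) : HodgeConjectureFor 3 (C ⊗ S) :=
  hodgeConjectureFor_tensor hC hS (algebraicClasses_eq_top_curve hC)
    (subsingleton_complexBetti_odd_curve hC h1) (algebraicClasses_eq_top_of_pg_zero hS hpg)
    (subsingleton_complexBetti_odd_of_b₁ hS hq)

end CohomologicallyAlgebraic

end Summit.HodgeConjecture.HodgeConjecture.Theorems

end
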